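import Summits.ABC.IUTFork.Cor312EdgeAggregateRealIVT
import HarnessLib

/-!
# [IUTchIII] Cor. 3.12 cone — NON-VACUITY of abc-iut-c312-6's `Cor312Vol.FrameVolumePieces`
# (`Cor312VolumesRealFrames`, 84 kernel consumers, no producer before this file) at a ONE-COMPLEX-FACTOR MODEL,
# jointly with the hypotheses `Realizes` / `0 < w_{i₀}` / "archimedean-type factor" of abc-iut-w5-d166's
# `Cor312EdgeAggregateRealIVT` (p416763)

PROOF-ONLY support file of the abc-iut cell (wave-5 prover seat abc-iut-w5-d166, gen 3; the cell-wide kernel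
inhabitation census of abc-iut-w5-d056, 2026-08-26T04:20Z, lists `FrameVolumePieces` among the C312 hypothesis
containers with consumers but no kernel term). NO `def`, NO `instance`, NO `structure` — the witnesses are built
inside the theorem terms (non-vacuity wave protocol). TAKES NO SIDE on [IUTchIII] Cor. 3.12.

`Cor312Vol.FrameVolumePieces L` ([IUTchIII] Rmk. 3.1.1 (ii) p. 94, Prop. 3.9 (i) p. 115, Rmk. 3.9.5 (i)/(ii) p. 127;
[AbsTopIII] Prop. 5.7 (i)/(ii) pp. 137–138) asks, at every tensor packet `I^ℚ(^{S^±_{j+1}};D⊢_{v_ℚ})` of a log-shell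
signature `L` (abc-iut-c312-1 `Thm311.LogShells`: `ℚ`-modules `log(D⊢_v)`, packets `⨂_ℚ ⊕_{v | v_ℚ} log(D⊢_v)`), for
finitely many nontrivially normed FIELD FACTORS `K_i`, a SURJECTIVE comparison `e` onto `Π_i K_i`, a factor volume and a
nonnegative weight per factor, and a hull frame whose hull-sets are exactly the `λ·𝒪_L`.

* §1 `exists_of_surjective` (general, not a model): ANY log-shell signature each of whose packets SURJECTS onto a
  finite product of copies of `ℂ` carries frame volume pieces with those factors, the RADIAL volume
  `FactorVolume.complexRadial` ([AbsTopIII] Prop. 5.7 (ii)) and weight `1` on every factor, and abc-iut-c312-7's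
  archimedean hull frame `HullFrame.ofNormSurjective` (Rmk. 3.9.5 (i)); every factor is then "archimedean-type"
  in the sense of p416763 (`∀ t, ∃ r > 0, μ^log(B(0,r)) = t`, by `complexRadial_exists_logvol_closedBall_eq`).
* §2 `exists_realizes_arch_model` — the MODEL (honest label): index skeleton with two places (`∞` archimedean, one
  nonarchimedean bad place; `l⋇ = 2`), `log(D⊢_v) := ℂ` at both (log-shell the `π`-ball, strip/sign automorphisms
  `{1}`), ONE complex factor per packet reached by the `ℚ`-multilinear multiplication
  `x_0 ⊗ ⋯ ⊗ x_j ↦ Π_i x_i(v)` (`PiTensorProduct.lift` of `MultilinearMap.mkPiAlgebra`), and the line data (a)(b)(c)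
  of every vertical line CARRYING these volumes (`Adm := V.Adm`, `logvol := V.logvol`, `Realizes` by `rfl`). Hence
  the hypothesis list `(hV : V.Realizes (S.D n))`, `i₀`, `(hw : 0 < w_{i₀})`, `hvol` of p416763
  `FrameVolumePieces.hullIVTAt_ofFrames` / `qCongruentSubHullAgg_of_statement_ofFrames` is JOINTLY SATISFIABLE at an
  archimedean `v_ℚ` (`¬ T.IsNon v_ℚ`); corollaries `exists_arch_model`, `exists_model`.

NOT initial Θ-data; at the nonarchimedean place the model also uses the complex factor (the structure does not tie
`K_i` to `IsNon`). Classical content only (`ℂ` with its norm, Mathlib `PiTensorProduct`). [claim: Mochizuki2012,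
status: disputed] for the quoted interface; typed ≠ proved; instantiated ≠ endorsed — a model witness certifies
CONSISTENCY of the hypothesis package, nothing more.
-/

noncomputable section

open Set Metric

namespace Summit.ABC.IUTFork.Cor312Vol.FrameVolumePieces

open Thm311 Cor312 Literature.IUT.LogVolume

/-! ## 1. Frame volume pieces from surjections onto products of copies of `ℂ` -/

/-- **Frame volume pieces from complex factors.** If every tensor packet `I^ℚ(^{S^±_{j+1}};D⊢_{v_ℚ})` of `L` surjects
onto a finite product `Π_{i ∈ ι_{j,v_ℚ}} ℂ`, then `L` carries `FrameVolumePieces` with these comparisons, the radial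
volume ([AbsTopIII] Prop. 5.7 (ii)) and weight `1` on every factor and the archimedean hull frame (Rmk. 3.9.5 (i));
in them every factor has positive weight and takes every real log-volume on closed discs.
[cite: MochizukiAbsTopIII2015, Prop. 5.7 (ii) p. 138] [claim: Mochizuki2012, status: disputed] -/
theorem exists_of_surjective {T : ThetaIndex} (L : LogShells T) (ι : T.Label → T.VQ → Type)
    [∀ j vQ, Fintype (ι j vQ)] (e : ∀ (j : T.Label) (vQ : T.VQ), L.Packet j vQ → (ι j vQ → ℂ))
    (he : ∀ j vQ, Function.Surjective (e j vQ)) :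
    ∃ V : FrameVolumePieces L, ∀ (j : T.Label) (vQ : T.VQ), Nonempty (V.J j vQ ≃ ι j vQ) ∧
      ∀ i : V.J j vQ, 0 < V.w j vQ i ∧
        ∀ t : ℝ, ∃ r : ℝ, 0 < r ∧ (V.vol j vQ i).logvol (closedBall 0 r) = t :=
  ⟨{ J := ι
     K := fun _ _ _ => ℂ
     e := e
     e_surjective := he
     vol := fun _ _ _ => FactorVolume.complexRadial
     w := fun _ _ _ => 1
     w_nonneg := fun _ _ _ => zero_le_one
     frameK := fun j vQ => HullFrame.ofNormSurjective (fun _ : ι j vQ => ℂ) (HullFrame.normSurjective_of_rclike ℂ _)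
     hul_iff := fun _ _ _ => Iff.rfl },
    fun _ _ => ⟨⟨Equiv.refl _⟩, fun _ => ⟨one_pos, FactorVolume.complexRadial_exists_logvol_closedBall_eq⟩⟩⟩

/-! ## 2. The one-complex-factor model -/

/-- **NON-VACUITY (model), jointly with the hypotheses of p416763.** There are an index skeleton `T`, a situation
`S` of [IUTchIII] Thm. 3.11 (abc-iut-c312-1 `Thm311.Situation`: log-shells and the data (a)(b)(c) of every vertical
line), frame volume pieces `V` on `S.L` and an ARCHIMEDEAN place `v_ℚ` such that every line's data REALIZES `V`
(`Realizes`: `Adm`/`logvol` are `V.Adm`/`V.logvol`) and at every packet over `v_ℚ` every field factor has positive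
weight and an archimedean-type volume. Model: two places, `log(D⊢_v) := ℂ`, one complex factor per packet via the
multiplication `x_0 ⊗ ⋯ ⊗ x_j ↦ Π_i x_i(v)`; not initial Θ-data. [claim: Mochizuki2012, status: disputed] -/
theorem exists_realizes_arch_model :
    ∃ (T : ThetaIndex) (S : Situation T) (V : FrameVolumePieces S.L) (vQ : T.VQ),
      ¬ T.IsNon vQ ∧ (∀ n : ℤ, V.Realizes (S.D n)) ∧
      ∀ j : T.Label, Nonempty (V.J j vQ) ∧ ∀ i : V.J j vQ, 0 < V.w j vQ i ∧
        ∀ t : ℝ, ∃ r : ℝ, 0 < r ∧ (V.vol j vQ i).logvol (closedBall 0 r) = t := by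
  -- the index skeleton: `∞ := false` (archimedean), `true` the nonarchimedean bad place; `l⋇ = 2`
  let T : ThetaIndex :=
    { lstar := 2, two_le_lstar := le_rfl, V := Bool, VQ := Bool, «over» := id, IsNon := fun b => b = true,
      fibre_finite := fun _ => Set.toFinite _, fibre_nonempty := fun b => ⟨b, rfl⟩, Vbad := {true},
      Vbad_nonempty := ⟨true, rfl⟩, Vbad_finite := Set.toFinite _, Vbad_non := fun _ h => h }
  -- the log-shells: `log(D⊢_v) := ℂ` everywhere
  let L : LogShells T :=
    { carrier := fun _ => ℂ, shell := fun _ => closedBall (0 : ℂ) Real.pi,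
      stripAut := fun _ => {LinearEquiv.refl ℚ ℂ}, ism := fun _ => {LinearEquiv.refl ℚ ℂ},
      one_mem_stripAut := fun _ => rfl, one_mem_ism := fun _ => rfl }
  -- the comparison: multiply the coordinates at the fibre point `v = v_ℚ` (`over = id`)
  let φ : ∀ (j : T.Label) (vQ : T.VQ), MultilinearMap ℚ (fun _ : T.Caps j => L.Packet1 vQ) ℂ := fun j vQ =>
    (MultilinearMap.mkPiAlgebra ℚ (T.Caps j) ℂ).compLinearMap fun _ =>
      (LinearMap.proj (⟨vQ, rfl⟩ : T.Fibre vQ) : (∀ v : T.Fibre vQ, L.carrier v.1) →ₗ[ℚ] ℂ)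
  let e : ∀ (j : T.Label) (vQ : T.VQ), L.Packet j vQ → (Unit → ℂ) := fun j vQ x _ =>
    PiTensorProduct.lift (φ j vQ) x
  have he : ∀ j vQ, Function.Surjective (e j vQ) := by
    intro j vQ f
    refine ⟨L.tprod j vQ (Fin.cons (fun _ => f ()) fun _ _ => 1), funext fun u => ?_⟩
    cases u
    show PiTensorProduct.lift (φ j vQ) (PiTensorProduct.tprod ℚ _) = f ()
    rw [PiTensorProduct.lift.tprod, MultilinearMap.compLinearMap_apply, MultilinearMap.mkPiAlgebra_apply,
      Fin.prod_univ_succ]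
    simp only [Fin.cons_zero, Fin.cons_succ, Finset.prod_const, Finset.card_univ,
      Fintype.card_fin]
    -- `proj_v (fun _ => c) = c` definitionally
    show f () * 1 ^ (j : ℕ) = f ()
    rw [one_pow, mul_one]
  obtain ⟨V, hV⟩ := exists_of_surjective L (fun _ _ => Unit) e he
  -- the situation: every vertical line's data (a)(b)(c) carries `V.Adm`, `V.logvol`
  let D : MRData L :=
    { shellPk := fun _ _ => ∅, shellSub := fun _ _ => ∅, Adm := V.Adm, logvol := V.logvol,
      Ψ := fun _ _ => ∅, act := fun _ _ _ => 0, Mmod := fun _ => ∅ }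
  let S : Situation T :=
    { L := L, D := fun _ => D,
      G := fun _ _ => { ObjMOD := Unit, Objmod := Unit, natIso := Equiv.refl Unit, deg := fun _ => 0,
                        region := fun _ _ => ∅ } }
  refine ⟨T, S, V, false, Bool.false_ne_true, fun _ => V.realizes_of_eq rfl rfl, fun j => ⟨?_, (hV j false).2⟩⟩
  obtain ⟨ε⟩ := (hV j false).1
  exact ⟨ε.symm ()⟩

/-- **NON-VACUITY (model) of the archimedean-factor hypotheses of p416763 on `FrameVolumePieces`**: some frame
volume pieces have, at some packet over an archimedean place, a field factor of positive weight whose volume takes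
every real log-volume on closed discs (the binders `i₀`, `hw`, `hvol` of `hullIVTAt_ofFrames`).
[claim: Mochizuki2012, status: disputed] -/
theorem exists_arch_model :
    ∃ (T : ThetaIndex) (L : LogShells T) (V : FrameVolumePieces L) (j : T.Label) (vQ : T.VQ) (i : V.J j vQ),
      ¬ T.IsNon vQ ∧ 0 < V.w j vQ i ∧ ∀ t : ℝ, ∃ r : ℝ, 0 < r ∧ (V.vol j vQ i).logvol (closedBall 0 r) = t := by
  obtain ⟨T, S, V, vQ, hvQ, -, h⟩ := exists_realizes_arch_model
  obtain ⟨⟨i⟩, hi⟩ := h 0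
  exact ⟨T, S.L, V, 0, vQ, i, hvQ, hi i⟩

/-- **NON-VACUITY (model) of `Cor312Vol.FrameVolumePieces`.** [claim: Mochizuki2012, status: disputed] -/
theorem exists_model : ∃ (T : ThetaIndex) (L : LogShells T), Nonempty (FrameVolumePieces L) := by
  obtain ⟨T, L, V, -⟩ := exists_arch_model
  exact ⟨T, L, ⟨V⟩⟩

end Summit.ABC.IUTFork.Cor312Vol.FrameVolumePieces

end
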